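import Literature.MathematicalPhysics.QuantumLattice.KaplanHorschVonDerLindenFieldBound
import HarnessLib

/-!
# Kaplan–Horsch–von der Linden (KT93 Theorem 7.1, (7.10)) for Koma–Tasaki `U(1)` systems: the finite-volume floor
# on the sourced order parameter of EVERY ground state of `H - B·O^{(1)}`, from a long-range-ordered eigenstate

T. Koma, H. Tasaki, *Symmetry breaking in Heisenberg antiferromagnets*, Commun. Math. Phys. **158** (1993) 191–214,
§7, Theorem 7.1 and its proof (7.4)–(7.10), with remark i') p. 210:

> i') `U_Λ Φ_Λ = λ Φ_Λ` … "implies that the expectation value of odd power of `O_Λ` in the ground state `Φ_Λ`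
> is vanishing"; (7.10) `N⁻¹(Φ_Λ(B), O_ΛΦ_Λ(B)) ≥ σ_Λ - O(N⁻¹)/(BN)`.

The tree's abstract form is `KomaTasaki.kaplanHorschVonDerLinden_order_density` (`KaplanHorschVonDerLindenFieldBound.lean`),
stated for ONE order operator `O = Σ_x o_x` with the odd moments `⟨Φ,OΦ⟩ = ⟨Φ,O³Φ⟩ = 0` as hypotheses.  This file
discharges those hypotheses for the order operator `O^{(1)}` of a Koma–Tasaki `U(1)` system (KT94 §2.3,
`KomaTasaki.U1System`) from the `U(1)` charge alone: for an eigenvector `Φ` of the generator `C`, every word of odd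
length in `O^± = O^{(1)} ± iO^{(2)}` shifts the `C`-charge by an odd integer ((2.16),
`U1System.C_orderPlus_apply` / `C_orderMinus_apply`), so `⟨Φ, O^{(1)}Φ⟩ = ⟨Φ, (O^{(1)})³Φ⟩ = 0`
(`inner_order_zero_eq_zero_of_eigen_C`, `inner_order_zero_cube_eq_zero_of_eigen_C`; KT94 (2.18) is the first).  Hence
(`U1System.kaplanHorschVonDerLinden_order_density`): for every `U1System`, every normalised eigenvector `Φ` of
`H_Λ` (eigenvalue the ground-state energy) and of `C`, with `(μōN)² ≤ Re⟨Φ,(O^{(1)})²Φ⟩`, `μ > 0`, every `B > 0` and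
EVERY ground state `Φ_B` of `H_Λ - B·O^{(1)}_Λ`,

  `N⁻¹ Re⟨Φ_B, O^{(1)}Φ_B⟩ ≥ μō - r²h̄/(μ²BN²)`

— factor `1` instead of the `√2` of Theorem 7.3, but NO size condition on `N` and an explicit `O(1/(BN²))` error (the
`√2` finite-volume form with its size condition `k²2^k ≤ μ^{2k}N` is `U1System.field_order_ge_xiState_of_card_ge`).
`μ ≤ 1` is derived, not assumed (`mu_le_one_of_re_inner_order_sq_ge`; cf. `U1System.mu_le_one_of_lro`).  In particular every `IsLROEigenstate`
(hypothesis iv)) qualifies (`…_of_isLROEigenstate`).  Instances: the XXZ / hard-core boson models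
(`XXZKT.u1System`, `XXZGroundStateKomaTasakiSystem.lean`) and Koma's `π`-flux BCS model (`KomaPiFlux.ktSystem`).

No definitions, no named facts, no sorry.

## References
* [KomaTasaki1993] T. Koma, H. Tasaki, Commun. Math. Phys. **158** (1993) 191–214, Theorem 7.1, (7.4)–(7.10), i').
* [KomaTasaki1994] T. Koma, H. Tasaki, J. Stat. Phys. **76** (1994) 745–803, §2.3 (2.12)–(2.18), Theorem 2.2.
* [KaplanHorschVonDerLinden1989] T. A. Kaplan, P. Horsch, W. von der Linden, J. Phys. Soc. Jpn. **58** (1989) 3894.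
* [Tasaki2019Tower] H. Tasaki, J. Stat. Phys. **174** (2019) 735–761, Theorem 2.1.
-/

noncomputable section

open Complex Finset Filter
open scoped InnerProductSpace ComplexConjugate Topology

namespace Literature.MathematicalPhysics.QuantumLattice.KomaTasaki

universe u v

variable {Λ : Type u} [Fintype Λ] {E : Type v} [NormedAddCommGroup E] [InnerProductSpace ℂ E]

namespace U1System

variable (sys : U1System Λ E)

/-! ### Charge bookkeeping: odd moments of `O^{(1)}` vanish in a `C`-eigenvector -/

/-- `O^+ + O^- = 2 O^{(1)}`. [cite: KomaTasaki1994, (2.15)] -/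
theorem orderPlus_add_orderMinus : sys.orderPlus + sys.orderMinus = (2 : ℂ) • sys.order 0 := by
  rw [orderPlus, orderMinus, two_smul]
  abel

/-- `2 O^{(1)} u = O^+ u + O^- u`. [cite: KomaTasaki1994, (2.15)] -/
theorem two_smul_order_zero_apply (u : E) : (2 : ℂ) • sys.order 0 u = sys.orderPlus u + sys.orderMinus u := by
  rw [← add_apply, orderPlus_add_orderMinus, smul_apply]

/-- `O^-` lowers the `C`-charge by one, additive form: `C (O^- u) = (a + (-1)) O^- u`. [cite: KomaTasaki1994, (2.16)] -/
theorem C_orderMinus_apply' {u : E} {a : ℂ} (hu : sys.C u = a • u) :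
    sys.C (sys.orderMinus u) = (a + (-1)) • sys.orderMinus u := by
  rw [← sub_eq_add_neg]
  exact sys.C_orderMinus_apply hu

/-- A word of length one with non-zero total charge shift has vanishing expectation in a `C`-eigenvector with real
eigenvalue. [cite: KomaTasaki1994, (2.16)–(2.18)] -/
theorem inner_chargeWord₁_eq_zero {Φ : E} {c : ℂ} (hC : sys.C Φ = c • Φ) (hc : conj c = c)
    {T₁ : E →L[ℂ] E} {s₁ : ℂ} (h₁ : ∀ (u : E) (a : ℂ), sys.C u = a • u → sys.C (T₁ u) = (a + s₁) • T₁ u)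
    (hs : s₁ ≠ 0) : ⟪Φ, T₁ Φ⟫_ℂ = 0 :=
  sys.inner_eq_zero_of_eigen_C hC (h₁ _ _ hC) (by
    rw [hc]
    intro h
    exact hs (by linear_combination -h))

/-- A word of length three with non-zero total charge shift has vanishing expectation in a `C`-eigenvector with
real eigenvalue. [cite: KomaTasaki1994, (2.16)–(2.18)] -/
theorem inner_chargeWord₃_eq_zero {Φ : E} {c : ℂ} (hC : sys.C Φ = c • Φ) (hc : conj c = c)
    {T₁ T₂ T₃ : E →L[ℂ] E} {s₁ s₂ s₃ : ℂ}
    (h₁ : ∀ (u : E) (a : ℂ), sys.C u = a • u → sys.C (T₁ u) = (a + s₁) • T₁ u)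
    (h₂ : ∀ (u : E) (a : ℂ), sys.C u = a • u → sys.C (T₂ u) = (a + s₂) • T₂ u)
    (h₃ : ∀ (u : E) (a : ℂ), sys.C u = a • u → sys.C (T₃ u) = (a + s₃) • T₃ u)
    (hs : s₁ + s₂ + s₃ ≠ 0) : ⟪Φ, T₃ (T₂ (T₁ Φ))⟫_ℂ = 0 :=
  sys.inner_eq_zero_of_eigen_C hC (h₃ _ _ (h₂ _ _ (h₁ _ _ hC))) (by
    rw [hc]
    intro h
    exact hs (by linear_combination -h))

/-- **KT94 (2.18) for `O^{(1)}`**: `⟨Φ, O^{(1)}Φ⟩ = 0` for every eigenvector `Φ` of `C` (`O^± ` shift the charge by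
`±1`; KT93 i'): "the expectation value of odd power of `O_Λ` … is vanishing").
[cite: KomaTasaki1994, (2.18)] [cite: KomaTasaki1993, §7 i') p. 210] -/
theorem inner_order_zero_eq_zero_of_eigen_C {Φ : E} {c : ℂ} (hC : sys.C Φ = c • Φ) :
    ⟪Φ, sys.order 0 Φ⟫_ℂ = 0 := by
  by_cases hΦ : Φ = 0
  · simp [hΦ]
  have hc : conj c = c := sys.conj_eq_of_eigen_C hΦ hC
  have hP : ∀ (u : E) (a : ℂ), sys.C u = a • u → sys.C (sys.orderPlus u) = (a + 1) • sys.orderPlus u :=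
    fun u a hu => sys.C_orderPlus_apply hu
  have hM : ∀ (u : E) (a : ℂ), sys.C u = a • u → sys.C (sys.orderMinus u) = (a + (-1)) • sys.orderMinus u :=
    fun u a hu => sys.C_orderMinus_apply' hu
  have h2 : (2 : ℂ) * ⟪Φ, sys.order 0 Φ⟫_ℂ = 0 := by
    rw [← inner_smul_right, two_smul_order_zero_apply, inner_add_right,
      sys.inner_chargeWord₁_eq_zero hC hc hP one_ne_zero, sys.inner_chargeWord₁_eq_zero hC hc hM (by norm_num),
      add_zero]
  exact (mul_eq_zero.mp h2).resolve_left two_ne_zero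

/-- **The third moment vanishes too**: `⟨Φ, (O^{(1)})³Φ⟩ = 0` for every eigenvector `Φ` of `C` (the eight words
of `(O^+ + O^-)³` shift the charge by `±1` or `±3`). [cite: KomaTasaki1993, §7 i') p. 210] [cite: KomaTasaki1994, (2.16)] -/
theorem inner_order_zero_cube_eq_zero_of_eigen_C {Φ : E} {c : ℂ} (hC : sys.C Φ = c • Φ) :
    ⟪Φ, sys.order 0 (sys.order 0 (sys.order 0 Φ))⟫_ℂ = 0 := by
  by_cases hΦ : Φ = 0
  · simp [hΦ]
  have hc : conj c = c := sys.conj_eq_of_eigen_C hΦ hC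
  have hP : ∀ (u : E) (a : ℂ), sys.C u = a • u → sys.C (sys.orderPlus u) = (a + 1) • sys.orderPlus u :=
    fun u a hu => sys.C_orderPlus_apply hu
  have hM : ∀ (u : E) (a : ℂ), sys.C u = a • u → sys.C (sys.orderMinus u) = (a + (-1)) • sys.orderMinus u :=
    fun u a hu => sys.C_orderMinus_apply' hu
  -- `(O^+ + O^-)³ Φ = 8 (O^{(1)})³ Φ`
  have key : (sys.orderPlus + sys.orderMinus) ((sys.orderPlus + sys.orderMinus)
      ((sys.orderPlus + sys.orderMinus) Φ)) = (8 : ℂ) • sys.order 0 (sys.order 0 (sys.order 0 Φ)) := by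
    rw [orderPlus_add_orderMinus]
    simp only [smul_apply, map_smul, smul_smul]
    norm_num
  -- the eight words
  have ePPP := sys.inner_chargeWord₃_eq_zero hC hc hP hP hP (by norm_num)
  have eMPP := sys.inner_chargeWord₃_eq_zero hC hc hM hP hP (by norm_num)
  have ePMP := sys.inner_chargeWord₃_eq_zero hC hc hP hM hP (by norm_num)
  have eMMP := sys.inner_chargeWord₃_eq_zero hC hc hM hM hP (by norm_num)
  have ePPM := sys.inner_chargeWord₃_eq_zero hC hc hP hP hM (by norm_num)
  have eMPM := sys.inner_chargeWord₃_eq_zero hC hc hM hP hM (by norm_num)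
  have ePMM := sys.inner_chargeWord₃_eq_zero hC hc hP hM hM (by norm_num)
  have eMMM := sys.inner_chargeWord₃_eq_zero hC hc hM hM hM (by norm_num)
  have h8 : (8 : ℂ) * ⟪Φ, sys.order 0 (sys.order 0 (sys.order 0 Φ))⟫_ℂ = 0 := by
    rw [← inner_smul_right, ← key]
    simp only [add_apply, map_add, inner_add_right, ePPP, eMPP, ePMP, eMMP, ePPM, eMPM, ePMM,
      eMMM, add_zero]
  exact (mul_eq_zero.mp h8).resolve_left (by norm_num)

/-! ### `μ ≤ 1` is automatic -/

/-- **`μ ≤ 1` from the long-range-order inequality** for either component: `(μōN)² ≤ Re⟨Φ,(O^{(α)})²Φ⟩` with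
`‖Φ‖ = 1` on a nonempty lattice forces `μ ≤ 1`. [cite: KomaTasaki1994, §2.3 iv) (2.17)] -/
theorem mu_le_one_of_re_inner_order_sq_ge [Nonempty Λ] (α : Fin 2) {Φ : E} (hΦ : ‖Φ‖ = 1) {μ : ℝ}
    (hlro : (μ * sys.obar * Fintype.card Λ) ^ 2 ≤ (⟪Φ, sys.order α (sys.order α Φ)⟫_ℂ).re) : μ ≤ 1 := by
  -- `Re⟨Φ,(O^{(α)})²Φ⟩ = ‖O^{(α)}Φ‖² ≤ (ōN)²` (`‖o_x‖ ≤ ō`, `‖Φ‖ = 1`)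
  have hO : ‖sys.order α‖ ≤ sys.obar * Fintype.card Λ :=
    calc ‖sys.order α‖ = ‖∑ y, sys.o α y‖ := rfl
      _ ≤ ∑ y, ‖sys.o α y‖ := norm_sum_le _ _
      _ ≤ ∑ _y : Λ, sys.obar := Finset.sum_le_sum fun y _ => sys.norm_o_le α y
      _ = sys.obar * Fintype.card Λ := by rw [Finset.sum_const, Finset.card_univ, nsmul_eq_mul, mul_comm]
  have hOΦ : ‖sys.order α Φ‖ ≤ sys.obar * Fintype.card Λ := by
    have := ContinuousLinearMap.le_opNorm (sys.order α) Φ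
    rw [hΦ, mul_one] at this
    exact this.trans hO
  have h : (μ * sys.obar * Fintype.card Λ) ^ 2 ≤ (sys.obar * Fintype.card Λ) ^ 2 := by
    refine hlro.trans ?_
    have h1 : ⟪Φ, sys.order α (sys.order α Φ)⟫_ℂ = ⟪sys.order α Φ, sys.order α Φ⟫_ℂ :=
      (sys.isSymmetric_order α Φ (sys.order α Φ)).symm
    have h4 : (⟪sys.order α Φ, sys.order α Φ⟫_ℂ).re = ‖sys.order α Φ‖ ^ 2 := by
      rw [inner_self_eq_norm_sq_to_K]; norm_cast
    rw [h1, h4]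
    exact pow_le_pow_left₀ (norm_nonneg _) hOΦ 2
  have hoN : 0 < sys.obar * Fintype.card Λ := mul_pos sys.obar_pos (Nat.cast_pos.mpr Fintype.card_pos)
  by_contra hμ1
  rw [not_le] at hμ1
  have h1 : sys.obar * Fintype.card Λ < μ * sys.obar * Fintype.card Λ := by
    have := mul_lt_mul_of_pos_right hμ1 hoN
    rw [one_mul, ← mul_assoc] at this
    exact this
  have h2 : (sys.obar * Fintype.card Λ) * (sys.obar * Fintype.card Λ) <
      (μ * sys.obar * Fintype.card Λ) * (μ * sys.obar * Fintype.card Λ) := mul_lt_mul'' h1 h1 hoN.le hoN.le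
  rw [pow_two, pow_two] at h
  linarith

/-! ### The theorem -/

/-- **KAPLAN–HORSCH–VON DER LINDEN FOR KOMA–TASAKI `U(1)` SYSTEMS (KT93 (7.10), finite volume, explicit constant,
no size condition).**  Let `sys` be a `U1System` on a nonempty lattice `Λ` (`N = |Λ|`), `Φ` a unit vector with
`H_ΛΦ = E_ΛΦ`, `C_ΛΦ = cΦ` and `(μōN)² ≤ Re⟨Φ,(O^{(1)}_Λ)²Φ⟩`, `μ > 0`, where `E_Λ` is the ground-state energy
(`E_Λ ≤ Re⟨ψ,H_Λψ⟩` for all unit `ψ`).  Then for every `B > 0` and EVERY unit `Φ_B` minimising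
`Re⟨ψ,(H_Λ - B·O^{(1)}_Λ)ψ⟩`:
**`N⁻¹ Re⟨Φ_B, O^{(1)}_ΛΦ_B⟩ ≥ μō - r²h̄/(μ²BN²)`**.  The odd moments of `O^{(1)}` in `Φ` vanish by the charge
bookkeeping above (KT93 i')); then `kaplanHorschVonDerLinden_order_density`.
[cite: KomaTasaki1993, Theorem 7.1 (7.10), i')] [cite: KomaTasaki1994, Theorem 2.2, §2.3] [cite: KaplanHorschVonDerLinden1989, main theorem] -/
theorem kaplanHorschVonDerLinden_order_density [Nonempty Λ] [FiniteDimensional ℂ E] {Φ : E} {EΛ μ : ℝ} {c : ℂ}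
    (hΦ1 : ‖Φ‖ = 1) (hHΦ : sys.hamiltonian Φ = (EΛ : ℂ) • Φ) (hC : sys.C Φ = c • Φ) (hμ : 0 < μ)
    (hlro : (μ * sys.obar * Fintype.card Λ) ^ 2 ≤ (⟪Φ, sys.order 0 (sys.order 0 Φ)⟫_ℂ).re)
    (hground : ∀ ψ : E, ‖ψ‖ = 1 → EΛ ≤ (⟪ψ, sys.hamiltonian ψ⟫_ℂ).re)
    {B : ℝ} (hB : 0 < B) {ΦB : E} (hΦB : ‖ΦB‖ = 1)
    (hmin : ∀ ψ : E, ‖ψ‖ = 1 →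
      (⟪ΦB, (sys.hamiltonian - (B : ℂ) • sys.order 0) ΦB⟫_ℂ).re ≤
        (⟪ψ, (sys.hamiltonian - (B : ℂ) • sys.order 0) ψ⟫_ℂ).re) :
    μ * sys.obar - (sys.r : ℝ) ^ 2 * sys.hbar / μ ^ 2 / (B * (Fintype.card Λ : ℝ) ^ 2) ≤
      (⟪ΦB, sys.order 0 ΦB⟫_ℂ).re / Fintype.card Λ :=
  KomaTasaki.kaplanHorschVonDerLinden_order_density sys.h (sys.o 0) sys.supp sys.r sys.hbar sys.obar μ Φ EΛ
    sys.isSymmetric_h (sys.isSymmetric_o 0) sys.norm_h_le (sys.norm_o_le 0) sys.obar_pos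
    (fun x y => by
      by_cases hxy : x = y
      · subst hxy
        exact Commute.refl _
      · exact sys.commute_o x y hxy 0 0)
    (fun x y hy => sys.commute_h_o x y hy 0) sys.card_supp_le hΦ1 hHΦ hground
    (sys.inner_order_zero_eq_zero_of_eigen_C hC) hμ (sys.mu_le_one_of_re_inner_order_sq_ge 0 hΦ1 hlro) hlro
    (sys.inner_order_zero_cube_eq_zero_of_eigen_C hC) hB hΦB hmin

/-- **The same for a state with obscured symmetry breaking iv)** (`IsLROEigenstate sys Φ E_Λ μ`, KT94 (2.17)) which is
a GROUND state: `N⁻¹ Re⟨Φ_B, O^{(1)}_ΛΦ_B⟩ ≥ μō - r²h̄/(μ²BN²)` for every ground state `Φ_B` of `H_Λ - B·O^{(1)}_Λ`,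
`B > 0`. [cite: KomaTasaki1993, Theorem 7.1 (7.10)] [cite: KomaTasaki1994, §2.3 iv), Theorem 2.2] -/
theorem kaplanHorschVonDerLinden_order_density_of_isLROEigenstate [Nonempty Λ] [FiniteDimensional ℂ E] {Φ : E}
    {EΛ μ : ℝ} (hΦ : IsLROEigenstate sys Φ EΛ μ)
    (hground : ∀ ψ : E, ‖ψ‖ = 1 → EΛ ≤ (⟪ψ, sys.hamiltonian ψ⟫_ℂ).re)
    {B : ℝ} (hB : 0 < B) {ΦB : E} (hΦB : ‖ΦB‖ = 1)
    (hmin : ∀ ψ : E, ‖ψ‖ = 1 →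
      (⟪ΦB, (sys.hamiltonian - (B : ℂ) • sys.order 0) ΦB⟫_ℂ).re ≤
        (⟪ψ, (sys.hamiltonian - (B : ℂ) • sys.order 0) ψ⟫_ℂ).re) :
    μ * sys.obar - (sys.r : ℝ) ^ 2 * sys.hbar / μ ^ 2 / (B * (Fintype.card Λ : ℝ) ^ 2) ≤
      (⟪ΦB, sys.order 0 ΦB⟫_ℂ).re / Fintype.card Λ := by
  obtain ⟨c, hC⟩ := hΦ.eigen_C
  exact sys.kaplanHorschVonDerLinden_order_density hΦ.norm_eq_one hΦ.eigen_hamiltonian hC hΦ.mu_pos hΦ.lro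
    hground hB hΦB hmin

end U1System

end Literature.MathematicalPhysics.QuantumLattice.KomaTasaki
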